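import Summits.ResolutionOfSingularities.ResolutionOfSingularities.Theorems.FrobeniusLadderFInjectiveMacaulayficationPointFixableAdicTransfer
import Literature.AlgebraicGeometry.Resolution.AdicNoetherian
import Mathlib.RingTheory.AdicCompletion.LocalRing
import Mathlib.RingTheory.AdicCompletion.AsTensorProduct
import HarnessLib

/-!
# `PFix` of an analytically irreducible Noetherian local domain is decided by its completion —
# the completion instance of 5i `pointFixable_adicTransfer` (crux stmt-ResolutionOfSingularities-15315, chain w45a, T-𝒫-loc)

[OURS · L1 W4.5a · res-D-pv-019 AS res-L1-w45a-stub-7] Support file (`--supports stmt-ResolutionOfSingularities-15315 --as helper`)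
for the crux `FrobeniusLadder.FInjectiveMacaulayfication`; NOT a statement of any manuscript; AI-written, weaker than expert review.

`pointFixable_iff_adicCompletion`: for a Noetherian local domain `A` whose `𝔪`-adic completion `Â` is a domain (analytically
irreducible), `PFix A ↔ PFix Â` (`PFix` spelled VERBATIM as in ClassGlueSig v3 5b′ / `PointFixableAdicTransfer`). This is 5i
`PointFixableAdicTransfer.pointFixable_adicTransfer` (p520478) applied to `A → Â`, whose hypotheses are in Mathlib / the tree:
`Â` is local with `𝔪_Â = 𝔪_A Â` (`AdicCompletion.maximalIdeal_eq_map`), `A → Â` is local (instance), flat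
(`AdicCompletion.flat_of_isNoetherian`), Noetherian (`Literature…AdicNoetherian`, Stacks 0316), and `A → Â/𝔪_Â^m` is onto
(`AdicCompletion.eval_surjective` + `pow_smul_top_eq_ker_eval`). Consequence for the crux (strat-1 PFixTowerSig §T2 use (ii), plan-1
R12.11): the residual statement 5e `h4Loc` only depends on the COMPLETE local rings `𝒪̂_{X₁,b}` (within the analytically
irreducible ones), so specimen computations decide it on whole 𝔪-adic isomorphism classes. No named facts; any `p : ℕ`.
-/

-- single-problem summit: the doubled namespace component is forced
set_option linter.dupNamespace false

noncomputable section

namespace Summit.ResolutionOfSingularities.ResolutionOfSingularities.Theorems.FInjectiveMacaulayfication.PointFixableCompletion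

open IsLocalRing Literature.AlgebraicGeometry.Resolution
open Summit.ResolutionOfSingularities.ResolutionOfSingularities.Theorems.FInjectiveMacaulayfication

/-- **`A → Â` is 𝔪-adically dense**: `A → Â/𝔪_Â^m` is surjective for every `m` (`Â` the `𝔪_A`-adic completion of a Noetherian
local ring `A`; `𝔪_Â^m = 𝔪_A^m Â` is the kernel of the `m`-th evaluation `Â → A/𝔪_A^m`). [folklore] -/
theorem adicCompletion_dense (A : Type*) [CommRing A] [IsLocalRing A] [IsNoetherianRing A] (m : ℕ) :
    Function.Surjective (fun a : A => Ideal.Quotient.mk (maximalIdeal (AdicCompletion (maximalIdeal A) A) ^ m)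
      (algebraMap A (AdicCompletion (maximalIdeal A) A) a)) := by
  intro z
  obtain ⟨x, rfl⟩ := Ideal.Quotient.mk_surjective z
  obtain ⟨a, ha⟩ := Submodule.Quotient.mk_surjective _ (AdicCompletion.eval (maximalIdeal A) A m x)
  refine ⟨a, ?_⟩
  beta_reduce
  rw [Ideal.Quotient.eq, AdicCompletion.maximalIdeal_eq_map, ← Ideal.map_pow, ← Submodule.restrictScalars_mem A,
    ← Ideal.smul_top_eq_map, AdicCompletion.pow_smul_top_eq_ker_eval (maximalIdeal A).fg_of_isNoetherianRing,
    LinearMap.mem_ker, map_sub, sub_eq_zero, AdicCompletion.algebraMap_apply, Algebra.algebraMap_self, RingHom.id_apply,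
    AdicCompletion.eval_of]
  exact ha

/-- **`PFix` is decided by the completion** (for analytically irreducible `A`): for a Noetherian local domain `A` whose `𝔪`-adic
completion `Â` is a domain, `PFix A ↔ PFix Â` — 5i `pointFixable_adicTransfer` for `A → Â` (flat, local, `𝔪_A Â = 𝔪_Â`, dense).
[folklore] -/
theorem pointFixable_iff_adicCompletion (p : ℕ) (A : Type) [CommRing A] [IsLocalRing A] [IsNoetherianRing A] [IsDomain A]
    [IsDomain (AdicCompletion (maximalIdeal A) A)] :
    (∃ (n : ℕ) (c : Fin n → A), Ideal.span (Set.range c) ≠ ⊥ ∧ (Ideal.span (Set.range c)).radical = IsLocalRing.maximalIdeal (A) ∧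
        ∀ (j : Fin n) (𝔔 : PrimeSpectrum (Literature.AlgebraicGeometry.Resolution.blowupAlgebra (Ideal.span (Set.range c)) (c j))),
          𝔔.asIdeal.comap (algebraMap (A) (Literature.AlgebraicGeometry.Resolution.blowupAlgebra (Ideal.span (Set.range c)) (c j))) = IsLocalRing.maximalIdeal (A) →
          IsDomain (Localization.AtPrime 𝔔.asIdeal) ∧ ∀ d : ℕ, ringKrullDim (Localization.AtPrime 𝔔.asIdeal) = d → ∀ s : Fin d → Localization.AtPrime 𝔔.asIdeal, (Ideal.span (Set.range s)).radical.IsMaximal → RingTheory.Sequence.IsWeaklyRegular (Localization.AtPrime 𝔔.asIdeal) (List.ofFn s) ∧ ∀ y : Localization.AtPrime 𝔔.asIdeal, (∃ e : ℕ, y ^ p ^ e ∈ Ideal.span ((fun z : Localization.AtPrime 𝔔.asIdeal => z ^ p ^ e) '' (Ideal.span (Set.range s) : Set (Localization.AtPrime 𝔔.asIdeal)))) → y ∈ Ideal.span (Set.range s)) ↔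
    (∃ (n : ℕ) (c : Fin n → AdicCompletion (maximalIdeal A) A), Ideal.span (Set.range c) ≠ ⊥ ∧
        (Ideal.span (Set.range c)).radical = IsLocalRing.maximalIdeal (AdicCompletion (maximalIdeal A) A) ∧
        ∀ (j : Fin n) (𝔔 : PrimeSpectrum (Literature.AlgebraicGeometry.Resolution.blowupAlgebra (Ideal.span (Set.range c)) (c j))),
          𝔔.asIdeal.comap (algebraMap (AdicCompletion (maximalIdeal A) A) (Literature.AlgebraicGeometry.Resolution.blowupAlgebra (Ideal.span (Set.range c)) (c j))) = IsLocalRing.maximalIdeal (AdicCompletion (maximalIdeal A) A) →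
          IsDomain (Localization.AtPrime 𝔔.asIdeal) ∧ ∀ d : ℕ, ringKrullDim (Localization.AtPrime 𝔔.asIdeal) = d → ∀ s : Fin d → Localization.AtPrime 𝔔.asIdeal, (Ideal.span (Set.range s)).radical.IsMaximal → RingTheory.Sequence.IsWeaklyRegular (Localization.AtPrime 𝔔.asIdeal) (List.ofFn s) ∧ ∀ y : Localization.AtPrime 𝔔.asIdeal, (∃ e : ℕ, y ^ p ^ e ∈ Ideal.span ((fun z : Localization.AtPrime 𝔔.asIdeal => z ^ p ^ e) '' (Ideal.span (Set.range s) : Set (Localization.AtPrime 𝔔.asIdeal)))) → y ∈ Ideal.span (Set.range s)) := by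
  haveI : IsNoetherianRing (AdicCompletion (maximalIdeal A) A) := isNoetherianRing_adicCompletion_maximalIdeal A
  exact PointFixableAdicTransfer.pointFixable_adicTransfer p A (AdicCompletion (maximalIdeal A) A)
    (AdicCompletion.maximalIdeal_eq_map (R := A)).symm (adicCompletion_dense A)

end Summit.ResolutionOfSingularities.ResolutionOfSingularities.Theorems.FInjectiveMacaulayfication.PointFixableCompletion

end
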